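import Summits.AtomisticToContinuum.Crystallization.Theorems.FrustratedLawDichotomyPeriodicBlockViolation

/-!
# FrustratedLawDichotomy · crux `AperiodicFrustratedLawGap` (stmt-AtomisticToContinuum-27623) — PERIODIC-BLOCK NEGATIVE KERNEL, ALL-BAD twin:
# a periodic cell whose interior classes are `η₁`-BAD (hence `η₀`-bad) with mean priced site energy below the level `c₀` refutes every pair-level
# law with that constant term — the T′♭ ceiling format (decomp-a2c, prover hand 1, generation 15; critic rows 543 (B3)(2) / 555 (B) / 564 (i))

Hand-2 g15's kernel `…PeriodicBlockViolation.not_pairLevelLaw_of_cell` hard-wires the interior flags `(η₀-bad, η₁-good)` (interior level `c₀ + c₂`,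
the E′♭ ceiling format).  The T′♭ ceiling of hand-1 g14 (`T′♭₄₅(κ_T)` false for `κ_T > 1.31·10⁻²`, numerically) uses ALL-`1/8`-BAD cells: interior flags
`(bad, bad)`, interior level `c₀`.  This file is the verbatim twin of hand-2's proof with that one change:

* ★ `not_pairLevelLaw_of_badCell` — cell data as in part B, every class centre NOT `(η₀, D)`- and NOT `(η₁, D)`-maybe-good in the supercell motif
  (`η₀, η₁ ≤ 3/10`, `13/10·D + 1 ≤ ϱ`), deficit `Σ_m [(Σ_q W − W 0)/2 − A] ≤ N₀·(c₀ − δ)`, `δ > 0` ⟹ `¬ PairLevelLaw W A c₀ c₁ c₂ η₀ η₁`;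
* `not_schurTopologicalPricing_of_badCell` — `T′♭(κ_T; C_T)` dies for EVERY `C_T` on an all-bad cell with mean priced `W`-site energy below
  `eUp + κ_T` by `δ` (its pair-level form has `c₀ = eUp + κ_T`); `not_schurRangeGap_of_badCell` — the FRG♭ twin (level `e₁`).

All `[folklore]`; 0 sorry.
-/

noncomputable section

namespace Summit.AtomisticToContinuum.Crystallization.Theorems.FrustratedLawDichotomyPeriodicBlockViolationBad

open scoped BigOperators Classical
open Metric
open Literature.MathematicalPhysics.StatisticalMechanics (interactionEnergy lennardJones)
open Summit.AtomisticToContinuum.Crystallization.Theorems.ChargedEnergyGapNegative (E3)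
open Summit.AtomisticToContinuum.Crystallization.Theorems.FrustratedLawDichotomyRangeCut
open Summit.AtomisticToContinuum.Crystallization.Theorems.FrustratedLawDichotomyMotifLemmas (GoodAtScale)
open Summit.AtomisticToContinuum.Crystallization.Theorems.FrustratedLawDichotomyMotifDoorE (MaybeGoodAt)
open Summit.AtomisticToContinuum.Crystallization.Theorems.FrustratedLawDichotomySchurCut
open Summit.AtomisticToContinuum.Crystallization.Theorems.FrustratedLawDichotomyPeriodicBlockGeometry
open Summit.AtomisticToContinuum.Crystallization.Theorems.FrustratedLawDichotomyPeriodicBlockKernel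
open Summit.AtomisticToContinuum.Crystallization.Theorems.FrustratedLawDichotomyPeriodicBlockViolation

/-- ★★ **THE PERIODIC-BLOCK NEGATIVE KERNEL, ALL-BAD INTERIOR.**  As `not_pairLevelLaw_of_cell`, but every class centre is NOT `(η₀, D)`- and NOT
`(η₁, D)`-maybe-good (`η₀, η₁ ≤ 3/10`), so interior sites carry the flags `(bad, bad)` and the interior level is `c₀`: the deficit
`Σ_m [(Σ_q W(|x_m − superMotif q|) − W 0)/2 − A] ≤ N₀·(c₀ − δ)`, `δ > 0`, refutes the pair-level law. [folklore] -/
theorem not_pairLevelLaw_of_badCell {N₀ M k₀ : ℕ} {x : Fin N₀ → E3} {a b : Fin 3 → E3} {cB ϱ diam : ℝ} (hN₀ : 1 ≤ N₀)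
    (hsep : PerSep x a) (hdual : ∀ j k, inner ℝ (b j) (a k) = if j = k then (1 : ℝ) else 0) (hb : ∀ j, ‖b j‖ ≤ cB)
    (hdiam : DiamLE x diam) (hk₀ : cB * (ϱ + diam) < k₀ + 1)
    {μ : Fin M → Fin N₀} {σ : Fin M → Fin 3 → ℤ} (hμσ : Function.Injective fun q => (μ q, σ q)) (hσ : ∀ q k, |σ q k| ≤ k₀)
    (hsup : ∀ (m : Fin N₀) (s : Fin 3 → ℤ), (∀ k, |s k| ≤ k₀) → ∃ q, μ q = m ∧ σ q = s)
    {cidx : Fin N₀ → Fin M} (hc : ∀ m, μ (cidx m) = m ∧ σ (cidx m) = 0)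
    {W : ℝ → ℝ} {R Wsup : ℝ} (hR0 : 0 ≤ R) (hW : ∀ r, R ≤ r → W r = 0) (hRϱ : R ≤ ϱ)
    (hWle : ∀ r, (7 : ℝ) / 10 ≤ r → W r ≤ Wsup) (hWsup : 0 ≤ Wsup)
    {η₀ η₁ D : ℝ} (hD : 13 / 10 * D + 1 ≤ ϱ) (hη₀ : η₀ ≤ 3 / 10) (hη₁ : η₁ ≤ 3 / 10)
    (hbad₀ : ∀ m, ¬ MaybeGoodAt η₀ D (superMotif x a μ σ) (cidx m)) (hbad₁ : ∀ m, ¬ MaybeGoodAt η₁ D (superMotif x a μ σ) (cidx m))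
    {A δ : ℝ} (hδ : 0 < δ) {c₀ c₁ c₂ : ℝ}
    (hdef : ∑ m, (((∑ q, W (dist (x m) (superMotif x a μ σ q))) - W 0) / 2 - A) ≤ N₀ * (c₀ - δ)) :
    ¬ PairLevelLaw W A c₀ c₁ c₂ η₀ η₁ := by
  intro hlaw
  -- boundary relief per site and the block size
  set β : ℝ := max (((20 * R / 7 + 1) ^ 3 * Wsup) / 2 - A - c₀ - min c₁ 0 - min c₂ 0) 0 with hβ
  have hβ0 : 0 ≤ β := le_max_right _ _
  have hβle : ((20 * R / 7 + 1) ^ 3 * Wsup) / 2 - A - c₀ - min c₁ 0 - min c₂ 0 ≤ β := le_max_left _ _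
  obtain ⟨n, hn4, hn1, hbig⟩ : ∃ n : ℕ, 4 * k₀ ≤ n ∧ 1 ≤ n ∧ 48 * (k₀ : ℝ) * β < δ * n := by
    obtain ⟨n₁, hn₁⟩ := exists_nat_gt (48 * (k₀ : ℝ) * β / δ)
    refine ⟨max (4 * k₀ + 1) n₁, by omega, by omega, ?_⟩
    have h1 : (n₁ : ℝ) ≤ ((max (4 * k₀ + 1) n₁ : ℕ) : ℝ) := by exact_mod_cast le_max_right _ _
    rw [div_lt_iff₀ hδ] at hn₁
    nlinarith
  -- re-index the `n`-block by `Fin N`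
  suffices key : ∀ (N : ℕ) (e : (Fin N₀ × (Fin 3 → Fin n)) ≃ Fin N), False from key _ (Fintype.equivFin _)
  intro N e
  have hNcard : Fintype.card (Fin N₀ × (Fin 3 → Fin n)) = N := card_reindex e
  have hNval : (N : ℝ) = N₀ * (n : ℝ) ^ 3 := by
    rw [← hNcard, Fintype.card_prod, Fintype.card_fin, Fintype.card_fun, Fintype.card_fin, Fintype.card_fin]
    push_cast
    ring
  have hYsep := block_sep hsep n
  have hYinj := block_injective hsep n
  have hmain := hlaw N (block x a n ∘ e.symm) (injective_reindex e hYinj) (sep_reindex e hYsep)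
  have h2U := interactionEnergy_reindex e (block x a n) W
  have hg₀ := goodCount_reindex e (block x a n) η₀
  have hg₁ := goodCount_reindex e (block x a n) η₁
  -- abbreviations: the flags, the site sums, the class deficits
  set ind₀ : Fin N₀ × (Fin 3 → Fin n) → ℝ := fun p => if GoodAt η₀ (block x a n ∘ e.symm) (e p) then (1 : ℝ) else 0 with hind₀
  set ind₁ : Fin N₀ × (Fin 3 → Fin n) → ℝ := fun p => if GoodAt η₁ (block x a n ∘ e.symm) (e p) then (1 : ℝ) else 0 with hind₁
  set S : Fin N₀ × (Fin 3 → Fin n) → ℝ := fun p => ∑ q, W (dist (block x a n p) (block x a n q)) with hSdef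
  set r : Fin N₀ → ℝ := fun m => ((∑ q, W (dist (x m) (superMotif x a μ σ q))) - W 0) / 2 - A with hr
  -- the doubled per-site excess has non-negative total (this is the law on the block)
  set X : Fin N₀ × (Fin 3 → Fin n) → ℝ := fun p => S p - W 0 - 2 * A - 2 * c₀ - 2 * c₁ * ind₀ p - 2 * c₂ * ind₁ p with hX
  have hXsum : ∑ p, X p = (∑ p, S p) - N * W 0 - N * (2 * A) - N * (2 * c₀) - 2 * c₁ * (∑ p, ind₀ p) - 2 * c₂ * (∑ p, ind₁ p) := by
    simp only [hX, Finset.sum_sub_distrib, Finset.sum_const, Finset.card_univ, hNcard, nsmul_eq_mul, ← Finset.mul_sum]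
  have hsumX : 0 ≤ ∑ p, X p := by
    rw [hXsum]
    rw [hg₀, hg₁] at hmain
    linarith only [hmain, h2U]
  -- interior sites: exact site sum, flags `(bad, bad)`
  have hint : ∀ p : Fin N₀ × (Fin 3 → Fin n), Interior k₀ n p.2 → X p = 2 * (r p.1 - c₀) := by
    rintro ⟨m, t⟩ ht
    have hS : S (m, t) = ∑ q, W (dist (x m) (superMotif x a μ σ q)) := by
      simp only [hSdef]
      exact siteSum_block_eq (n := n) hsep hdual hb hdiam hk₀ hμσ hσ hsup hW hRϱ ht m
    have hB₁ : ¬ GoodAt η₁ (block x a n ∘ e.symm) (e (m, t)) :=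
      not_goodAt_block_of_superMotif hsep hdual hb hdiam hk₀ hμσ hσ hsup hc hD hη₁ e ht (hbad₁ m)
    have hB : ¬ GoodAt η₀ (block x a n ∘ e.symm) (e (m, t)) :=
      not_goodAt_block_of_superMotif hsep hdual hb hdiam hk₀ hμσ hσ hsup hc hD hη₀ e ht (hbad₀ m)
    have h0 : ind₀ (m, t) = 0 := by simp only [hind₀]; exact if_neg hB
    have h1 : ind₁ (m, t) = 0 := by simp only [hind₁]; exact if_neg hB₁
    simp only [hX, hr, h0, h1, hS]
    ring
  -- boundary sites: `X p ≤ 2β`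
  have hbdry : ∀ p : Fin N₀ × (Fin 3 → Fin n), X p ≤ 2 * β := by
    intro p
    have hS : S p ≤ W 0 + (20 * R / 7 + 1) ^ 3 * Wsup := by
      simp only [hSdef]
      exact siteSum_le_of_sep hYinj hYsep hR0 hW hWle hWsup p
    have h₀ : min c₁ 0 ≤ c₁ * ind₀ p := by
      by_cases hq : GoodAt η₀ (block x a n ∘ e.symm) (e p)
      · have : ind₀ p = 1 := by simp only [hind₀]; exact if_pos hq
        rw [this, mul_one]; exact min_le_left _ _
      · have : ind₀ p = 0 := by simp only [hind₀]; exact if_neg hq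
        rw [this, mul_zero]; exact min_le_right _ _
    have h₁ : min c₂ 0 ≤ c₂ * ind₁ p := by
      by_cases hq : GoodAt η₁ (block x a n ∘ e.symm) (e p)
      · have : ind₁ p = 1 := by simp only [hind₁]; exact if_pos hq
        rw [this, mul_one]; exact min_le_left _ _
      · have : ind₁ p = 0 := by simp only [hind₁]; exact if_neg hq
        rw [this, mul_zero]; exact min_le_right _ _
    have hXp : X p = S p - W 0 - 2 * A - 2 * c₀ - 2 * c₁ * ind₀ p - 2 * c₂ * ind₁ p := rfl
    rw [hXp]
    linarith only [hS, h₀, h₁, hβle]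
  -- split the total into interior and boundary
  have hsplit := (Finset.sum_filter_add_sum_filter_not (Finset.univ : Finset (Fin N₀ × (Fin 3 → Fin n)))
    (fun p => Interior k₀ n p.2) X).symm
  have hI : ∑ p ∈ Finset.univ.filter (fun p : Fin N₀ × (Fin 3 → Fin n) => Interior k₀ n p.2), X p =
      (interiorSet k₀ n).card * ∑ m, 2 * (r m - c₀) := by
    rw [← sum_interior_class]
    exact Finset.sum_congr rfl fun p hp => hint p (Finset.mem_filter.1 hp).2
  have hB : ∑ p ∈ Finset.univ.filter (fun p : Fin N₀ × (Fin 3 → Fin n) => ¬ Interior k₀ n p.2), X p ≤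
      N₀ * ((n : ℝ) ^ 3 - (interiorSet k₀ n).card) * (2 * β) := by
    rw [← card_boundary N₀ k₀ n]
    have := Finset.sum_le_card_nsmul (Finset.univ.filter (fun p : Fin N₀ × (Fin 3 → Fin n) => ¬ Interior k₀ n p.2)) X (2 * β)
      fun p _ => hbdry p
    rwa [nsmul_eq_mul] at this
  -- the class deficit
  have hdef' : ∑ m, 2 * (r m - c₀) ≤ -(2 * N₀ * δ) := by
    have h1 : ∑ m, 2 * (r m - c₀) = 2 * (∑ m, r m) - 2 * N₀ * c₀ := by
      rw [← Finset.mul_sum, Finset.sum_sub_distrib, Finset.sum_const, Finset.card_univ, Fintype.card_fin, nsmul_eq_mul]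
      ring
    rw [h1]
    have h2 : ∑ m, r m ≤ N₀ * (c₀ - δ) := by simp only [hr]; exact hdef
    linarith only [h2]
  -- interior count bounds
  have hcardI : ((n : ℝ) - 2 * k₀) ^ 3 ≤ (interiorSet k₀ n).card := by
    have h := card_interior_ge (k₀ := k₀) (n := n) (by omega)
    have h' : (((n - 2 * k₀) ^ 3 : ℕ) : ℝ) ≤ (interiorSet k₀ n).card := by exact_mod_cast h
    have hsub : ((n - 2 * k₀ : ℕ) : ℝ) = (n : ℝ) - 2 * k₀ := by
      rw [Nat.cast_sub (by omega)]
      push_cast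
      ring
    rw [Nat.cast_pow, hsub] at h'
    exact h'
  have harith := block_arith hδ hβ0 hn4 hn1 hbig
  have hN₀' : (1 : ℝ) ≤ N₀ := by exact_mod_cast hN₀
  have hT0 : ∑ m, 2 * (r m - c₀) ≤ 0 := by
    have : (0 : ℝ) ≤ 2 * N₀ * δ := by positivity
    linarith only [hdef', this]
  have hIle : ((interiorSet k₀ n).card : ℝ) * ∑ m, 2 * (r m - c₀) ≤ ((n : ℝ) - 2 * k₀) ^ 3 * (-(2 * N₀ * δ)) := by
    have h1 : ((interiorSet k₀ n).card : ℝ) * ∑ m, 2 * (r m - c₀) ≤ ((n : ℝ) - 2 * k₀) ^ 3 * ∑ m, 2 * (r m - c₀) :=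
      mul_le_mul_of_nonpos_right hcardI hT0
    have h2 : ((n : ℝ) - 2 * k₀) ^ 3 * ∑ m, 2 * (r m - c₀) ≤ ((n : ℝ) - 2 * k₀) ^ 3 * (-(2 * N₀ * δ)) := by
      have hu : (0 : ℝ) ≤ ((n : ℝ) - 2 * k₀) ^ 3 := by
        have : (0 : ℝ) ≤ (n : ℝ) - 2 * k₀ := by
          have : 4 * (k₀ : ℝ) ≤ n := by exact_mod_cast hn4
          linarith
        positivity
      exact mul_le_mul_of_nonneg_left hdef' hu
    exact h1.trans h2
  have hBle : (N₀ : ℝ) * ((n : ℝ) ^ 3 - (interiorSet k₀ n).card) * (2 * β) ≤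
      N₀ * ((n : ℝ) ^ 3 - ((n : ℝ) - 2 * k₀) ^ 3) * (2 * β) := by
    have h1 : (n : ℝ) ^ 3 - (interiorSet k₀ n).card ≤ (n : ℝ) ^ 3 - ((n : ℝ) - 2 * k₀) ^ 3 := by linarith only [hcardI]
    have hN₀0 : (0 : ℝ) ≤ N₀ := by linarith only [hN₀']
    have h2β : (0 : ℝ) ≤ 2 * β := by linarith only [hβ0]
    have := mul_le_mul_of_nonneg_left h1 hN₀0
    exact mul_le_mul_of_nonneg_right this h2β
  have hneg : ((n : ℝ) - 2 * k₀) ^ 3 * (-(2 * N₀ * δ)) + N₀ * ((n : ℝ) ^ 3 - ((n : ℝ) - 2 * k₀) ^ 3) * (2 * β) < 0 := by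
    have : ((n : ℝ) - 2 * k₀) ^ 3 * (-(2 * N₀ * δ)) + N₀ * ((n : ℝ) ^ 3 - ((n : ℝ) - 2 * k₀) ^ 3) * (2 * β) =
        2 * N₀ * (β * ((n : ℝ) ^ 3 - ((n : ℝ) - 2 * k₀) ^ 3) - δ * ((n : ℝ) - 2 * k₀) ^ 3) := by ring
    rw [this]
    have h2N : (0 : ℝ) < 2 * N₀ := by linarith only [hN₀']
    have hin : β * ((n : ℝ) ^ 3 - ((n : ℝ) - 2 * k₀) ^ 3) - δ * ((n : ℝ) - 2 * k₀) ^ 3 < 0 := by linarith only [harith]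
    exact mul_neg_of_pos_of_neg h2N hin
  rw [hsplit, hI] at hsumX
  linarith only [hsumX, hB, hIle, hBle, hneg]

/-- ★ **T′♭ DIES FOR EVERY `C_T`** on an all-bad cell (`η₀, η₁ ≤ 3/10`) with mean priced `W`-site energy below `eUp + κ_T` by `δ`:
`¬ SchurTopologicalPricing η₀ η₁ w ω A eUp κ_T C_T` (its pair-level form has constant term `c₀ = eUp + κ_T`). [folklore] -/
theorem not_schurTopologicalPricing_of_badCell {N₀ M k₀ : ℕ} {x : Fin N₀ → E3} {a b : Fin 3 → E3} {cB ϱ diam : ℝ} (hN₀ : 1 ≤ N₀)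
    (hsep : PerSep x a) (hdual : ∀ j k, inner ℝ (b j) (a k) = if j = k then (1 : ℝ) else 0) (hb : ∀ j, ‖b j‖ ≤ cB)
    (hdiam : DiamLE x diam) (hk₀ : cB * (ϱ + diam) < k₀ + 1)
    {μ : Fin M → Fin N₀} {σ : Fin M → Fin 3 → ℤ} (hμσ : Function.Injective fun q => (μ q, σ q)) (hσ : ∀ q k, |σ q k| ≤ k₀)
    (hsup : ∀ (m : Fin N₀) (s : Fin 3 → ℤ), (∀ k, |s k| ≤ k₀) → ∃ q, μ q = m ∧ σ q = s)
    {cidx : Fin N₀ → Fin M} (hc : ∀ m, μ (cidx m) = m ∧ σ (cidx m) = 0)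
    {w ω : ℝ → ℝ} {A R Wsup : ℝ} (hR0 : 0 ≤ R) (hW : ∀ r, R ≤ r → effPot w ω A r = 0) (hRϱ : R ≤ ϱ)
    (hWle : ∀ r, (7 : ℝ) / 10 ≤ r → effPot w ω A r ≤ Wsup) (hWsup : 0 ≤ Wsup)
    {η₀ η₁ D : ℝ} (hD : 13 / 10 * D + 1 ≤ ϱ) (hη₀ : η₀ ≤ 3 / 10) (hη₁ : η₁ ≤ 3 / 10)
    (hbad₀ : ∀ m, ¬ MaybeGoodAt η₀ D (superMotif x a μ σ) (cidx m)) (hbad₁ : ∀ m, ¬ MaybeGoodAt η₁ D (superMotif x a μ σ) (cidx m))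
    {eUp κT δ : ℝ} (hδ : 0 < δ)
    (hdef : ∑ m, (((∑ q, effPot w ω A (dist (x m) (superMotif x a μ σ q))) - effPot w ω A 0) / 2 - A) ≤ N₀ * (eUp + κT - δ))
    (CT : ℝ) : ¬ SchurTopologicalPricing η₀ η₁ w ω A eUp κT CT := fun h =>
  not_pairLevelLaw_of_badCell hN₀ hsep hdual hb hdiam hk₀ hμσ hσ hsup hc hR0 hW hRϱ hWle hWsup hD hη₀ hη₁ hbad₀ hbad₁ hδ
    (c₁ := -CT) (c₂ := -κT) hdef (pairLevelLaw_of_schurTopologicalPricing h)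

/-- **FRG♭ also dies** on an all-bad cell with mean priced site energy below `e₁` by `δ` (every `C`; `η₁ ≤ 3/10` arbitrary). [folklore] -/
theorem not_schurRangeGap_of_badCell {N₀ M k₀ : ℕ} {x : Fin N₀ → E3} {a b : Fin 3 → E3} {cB ϱ diam : ℝ} (hN₀ : 1 ≤ N₀)
    (hsep : PerSep x a) (hdual : ∀ j k, inner ℝ (b j) (a k) = if j = k then (1 : ℝ) else 0) (hb : ∀ j, ‖b j‖ ≤ cB)
    (hdiam : DiamLE x diam) (hk₀ : cB * (ϱ + diam) < k₀ + 1)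
    {μ : Fin M → Fin N₀} {σ : Fin M → Fin 3 → ℤ} (hμσ : Function.Injective fun q => (μ q, σ q)) (hσ : ∀ q k, |σ q k| ≤ k₀)
    (hsup : ∀ (m : Fin N₀) (s : Fin 3 → ℤ), (∀ k, |s k| ≤ k₀) → ∃ q, μ q = m ∧ σ q = s)
    {cidx : Fin N₀ → Fin M} (hc : ∀ m, μ (cidx m) = m ∧ σ (cidx m) = 0)
    {w ω : ℝ → ℝ} {A R Wsup : ℝ} (hR0 : 0 ≤ R) (hW : ∀ r, R ≤ r → effPot w ω A r = 0) (hRϱ : R ≤ ϱ)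
    (hWle : ∀ r, (7 : ℝ) / 10 ≤ r → effPot w ω A r ≤ Wsup) (hWsup : 0 ≤ Wsup)
    {η₁ D : ℝ} (hD : 13 / 10 * D + 1 ≤ ϱ) (hη₁ : η₁ ≤ 3 / 10)
    (hbad₀ : ∀ m, ¬ MaybeGoodAt (1 / 20) D (superMotif x a μ σ) (cidx m)) (hbad₁ : ∀ m, ¬ MaybeGoodAt η₁ D (superMotif x a μ σ) (cidx m))
    {e₁ δ : ℝ} (hδ : 0 < δ)
    (hdef : ∑ m, (((∑ q, effPot w ω A (dist (x m) (superMotif x a μ σ q))) - effPot w ω A 0) / 2 - A) ≤ N₀ * (e₁ - δ))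
    (C : ℝ) : ¬ SchurRangeGap w ω A e₁ C := fun h =>
  not_pairLevelLaw_of_badCell hN₀ hsep hdual hb hdiam hk₀ hμσ hσ hsup hc hR0 hW hRϱ hWle hWsup hD (by norm_num) hη₁ hbad₀ hbad₁ hδ
    (c₁ := -C) (c₂ := 0) hdef (pairLevelLaw_of_schurRangeGap η₁ h)

end Summit.AtomisticToContinuum.Crystallization.Theorems.FrustratedLawDichotomyPeriodicBlockViolationBad

end
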